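import Literature.MathematicalPhysics.QuantumLattice.FermionQuasiFreeWick
import Literature.MathematicalPhysics.QuantumLattice.FermionQuasiFreeDynamics
import Literature.Analysis.InnerProduct.GramHadamard
import HarnessLib

/-!
# Quasi-free Gibbs states of lattice fermions, IV: the Gram–Hadamard bound on the moments

Topic `MathematicalPhysics/QuantumLattice`; no definitions, no named facts. Puts together the
determinant formula of the thermal Wick theorem (`FermionQuasiFreeWick.gibbsState_dGamma_nestedWord`:
`⟨c†_{i₀}⋯c†_{i_{n-1}} c_{j_{n-1}}⋯c_{j₀}⟩_β = det[⟨c†_{i_k} c_{j_l}⟩]`) and the Gram–Hadamard inequality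
(`Literature.Analysis.InnerProduct.norm_det_inner_le_prod_norm_mul_prod_norm`) into the basic
`n!`-free bound on fermionic moments that drives the convergence of fermionic expansions
(Mastropietro, *Non-Perturbative Renormalization* (2008), Lemma 2.2 and §2.2; Benfatto–Giuliani–
Mastropietro 2006, (2.80); the programme under the tree's fact `bgm_two_point_limit`):

* `posSemidef_fermiMatrix`, `fermiMatrix_diag_re_le_one` — the Fermi matrix `Φ = (1 + e^{βh})⁻¹` of
  a Hermitian `h` is positive semidefinite with diagonal in `[0, 1]`;
* `norm_gibbsState_dGamma_nestedWord_le_one` — `|⟨c†_{i₀}⋯c†_{i_{n-1}} c_{j_{n-1}}⋯c_{j₀}⟩_β| ≤ 1`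
  for every `n` and all indices (Gram representation `Φ = Bᴴ B`, columns of norm `≤ 1`).

## References

* V. Mastropietro, *Non-Perturbative Renormalization* (World Scientific 2008), §2.2, Lemma 2.2,
  eq. (2.66). [Mastropietro2008]
* G. Benfatto, A. Giuliani, V. Mastropietro, Ann. Henri Poincaré 7 (2006) 809–898, §2.8, (2.80).
  [BenfattoGiulianiMastropietro2006]
-/

noncomputable section

open NormedSpace Matrix Finset
open scoped ComplexOrder MatrixOrder InnerProductSpace Matrix.Norms.L2Operator

namespace Literature.MathematicalPhysics.QuantumLattice

variable {ι : Type*} [LinearOrder ι] [Fintype ι]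

/-- The Fermi matrix `(1 + e^{βh})⁻¹` of a Hermitian `h` is positive semidefinite. [folklore] -/
theorem posSemidef_fermiMatrix {h : Matrix ι ι ℂ} (hh : h.IsHermitian) (β : ℝ) :
    ((1 + exp ((β : ℂ) • h))⁻¹).PosSemidef :=
  (posDef_one_add_exp_smul hh β).inv.posSemidef

/-- The diagonal of the Fermi matrix lies in `[0, 1]`: `0 ≤ [(1 + e^{βh})⁻¹]_{aa} ≤ 1`
(`1 - (1 + e^{βh})⁻¹ = (1 + e^{-βh})⁻¹ ≥ 0`). [folklore] -/
theorem fermiMatrix_diag_re_le_one {h : Matrix ι ι ℂ} (hh : h.IsHermitian) (β : ℝ) (a : ι) :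
    ((1 + exp ((β : ℂ) • h))⁻¹ a a).re ≤ 1 := by
  have hc : (1 - (1 + exp ((β : ℂ) • h))⁻¹).PosSemidef := by
    rw [one_sub_fermiMatrix hh β]
    have := (posDef_one_add_exp_smul hh (-β)).inv.posSemidef
    simpa using this
  have h0 : (0 : ℂ) ≤ (1 - (1 + exp ((β : ℂ) • h))⁻¹) a a := hc.diag_nonneg
  rw [Matrix.sub_apply, Matrix.one_apply_eq] at h0
  have := (Complex.nonneg_iff.1 h0).1
  simp only [Complex.sub_re, Complex.one_re] at this
  linarith

/-- **The moments of a quasi-free Gibbs state are bounded by one, uniformly in the order**: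
for Hermitian `h`, real `β` and any `n`,
`|⟨c†_{i₀} ⋯ c†_{i_{n-1}} c_{j_{n-1}} ⋯ c_{j₀}⟩_β| ≤ 1` — no `n!`: the determinant formula
(`gibbsState_dGamma_nestedWord`) exhibits the moment as `det [Φ_{j_l i_k}]` for the positive
semidefinite Fermi matrix `Φ = (1 + e^{βh})⁻¹ = Bᴴ B`, i.e. as a determinant of inner products of
the columns of `B`, of norms `Φ_{aa}^{1/2} ≤ 1`, and the Gram–Hadamard inequality
(`Literature.Analysis.InnerProduct.norm_det_inner_le_prod_norm_mul_prod_norm`) applies. This is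
the mechanism ("Gram inequality", Mastropietro 2008 Lemma 2.2; BGM 2006 (2.80)) by which fermionic
expansions converge. [cite: Mastropietro2008, Lemma 2.2 eq. (2.66)] -/
theorem norm_gibbsState_dGamma_nestedWord_le_one {h : Matrix ι ι ℂ} (hh : h.IsHermitian) (β : ℝ)
    (n : ℕ) (i j : Fin n → ι) :
    ‖gibbsState β (dGamma h) (wordOp (nestedWord n i j))‖ ≤ 1 := by
  set Φ : Matrix ι ι ℂ := (1 + exp ((β : ℂ) • h))⁻¹ with hΦ
  -- `Φ = Bᴴ B`
  obtain ⟨B, hB⟩ := CStarAlgebra.nonneg_iff_eq_star_mul_self.mp (posSemidef_fermiMatrix hh β).nonneg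
  rw [← hΦ] at hB
  -- the columns of `B` as vectors of `ℂ^ι`
  let col : ι → EuclideanSpace ℂ ι := fun a => WithLp.toLp 2 fun k => B k a
  have hinner : ∀ a b, ⟪col a, col b⟫_ℂ = Φ a b := by
    intro a b
    rw [hB, star_eq_conjTranspose, Matrix.mul_apply, PiLp.inner_apply]
    simp only [col, Matrix.conjTranspose_apply, RCLike.inner_apply, Complex.star_def]
    exact Finset.sum_congr rfl fun _ _ => mul_comm _ _
  have hnorm : ∀ a, ‖col a‖ ≤ 1 := by
    intro a
    have h2 : ‖col a‖ ^ 2 ≤ 1 := by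
      rw [@norm_sq_eq_re_inner ℂ, hinner]
      exact fermiMatrix_diag_re_le_one hh β a
    nlinarith [norm_nonneg (col a)]
  -- the determinant formula
  rw [gibbsState_dGamma_nestedWord hh]
  have hherm : Φ.IsHermitian := (posSemidef_fermiMatrix hh β).isHermitian
  have hM : (Matrix.of fun k l => gibbsState β (dGamma h) (creation (i k) * annihilation (j l))) =
      ((Matrix.of fun k l => ⟪col (i k), col (j l)⟫_ℂ)ᴴ)ᵀ := by
    ext k l
    simp only [Matrix.of_apply, Matrix.transpose_apply, Matrix.conjTranspose_apply, hinner]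
    rw [hherm.apply (j l) (i k)]
    exact thermalCorr_dGamma_creation_annihilation hh β (i k) (j l)
  rw [hM, det_transpose, det_conjTranspose, norm_star]
  refine (Literature.Analysis.InnerProduct.norm_det_inner_le_prod_norm_mul_prod_norm _ _).trans ?_
  have h1 : ∏ k : Fin n, ‖col (i k)‖ ≤ 1 := by
    calc ∏ k : Fin n, ‖col (i k)‖ ≤ ∏ _k : Fin n, (1 : ℝ) :=
          Finset.prod_le_prod (fun _ _ => norm_nonneg _) fun k _ => hnorm (i k)
      _ = 1 := by simp
  have h2 : ∏ l : Fin n, ‖col (j l)‖ ≤ 1 := by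
    calc ∏ l : Fin n, ‖col (j l)‖ ≤ ∏ _l : Fin n, (1 : ℝ) :=
          Finset.prod_le_prod (fun _ _ => norm_nonneg _) fun l _ => hnorm (j l)
      _ = 1 := by simp
  calc (∏ k : Fin n, ‖col (i k)‖) * ∏ l : Fin n, ‖col (j l)‖ ≤ 1 * 1 :=
        mul_le_mul h1 h2 (Finset.prod_nonneg fun _ _ => norm_nonneg _) zero_le_one
    _ = 1 := one_mul 1

end Literature.MathematicalPhysics.QuantumLattice
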